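import Summits.Schanuel.Schanuel.Theorems.ZilberEacGraphCurveDensity
import HarnessLib

/-!
# Graph base × arbitrary curve, V: the case certificate and examples

HONEST FRAMING.  Cell `pub-schanuel` (Zilber's Exponential-Algebraic Closedness, case ladder;
host summit Schanuel), seat 2, gen 16.  Closing file of the series `ZilberEacGraphCurve*` on the
split surfaces

  `W(p; P) = {x₁ = p(x₀)} × Z(P) ⊆ ℂ² × ℂ²`, `deg p ≥ 2`, `P ∈ ℂ[y₀, y₁]`.

The density theorem `unprojectedDense_graphCurveSurface` of file IV answers Mantova–Masser's
"unprojected density" question (D. Masser, V. Mantova, *Polynomial-exponential equations — some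
new cases of solvability*, PLMS 129 (2024) = arXiv:2303.05592, §1 p. 5; OPEN in general) on this
family.  Here we certify that the family lies in their case (dim-π-S-1-free), so that the instance
is not vacuous, and record examples with NON-GRAPH fibre curves:

* `projAdd_image_graphCurveSurface_inter_torusLocus`: `π(W ∩ G²)` is the whole base curve
  `x₁ = p(x₀)` (given one torus zero of `P`); hence `addProjDim W = 1` and the closure of the base is
  not a line of rational slope (`deg p ≥ 2`), both transferred from the crossed graph surface
  `{x₁ = p(x₀), y₀ = y₁}` of `EACDensityFamilies`, which has the same base;
* `mmCase_graphCurveSurface`: for irreducible `P` with a torus zero and `deg p ≥ 2`, `W(p; P)` IS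
  in case (dim-π-S-1-free); `unprojectedDensityQuestion_instance_graphCurve`: case ∧ dense;
* examples: the parabola × circle `{x₁ = x₀², y₀² + y₁² = 2}` (`exp (2z) + exp (2z²) = 2`) and the
  cubic × Fermat conic `{x₁ = x₀³ - x₀, y₀² + y₁² = 1}` have Zariski-dense exponential points —
  fibre curves of genus `0` that are NOT graphs over either multiplicative coordinate, outside every
  earlier file of the cell.

This is a modest rung in the case ladder of EAC.  It is NOT Schanuel's conjecture (neither used nor
implied; EAC ⇏ SC); `EC(3,2)` stays OPEN, and so does the density question over base curves that
are not graphs over a coordinate axis.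
-/

noncomputable section

open Filter Topology Set Complex MvPolynomial
open Literature.NumberTheory.Transcendental Literature.ModelTheory.Zilber
open Literature.ModelTheory.ExponentialFields

set_option linter.dupNamespace false

namespace Summit.Schanuel.Schanuel.Theorems

/-! ## Part A. The additive projection of `W ∩ G²` and the case certificate -/

section Case

variable (p : Polynomial ℂ) {P : MvPolynomial (Fin 2) ℂ}

/-- Torus points of `W(p; P)` ↔ torus zeros of `P`. (new) -/
theorem graphCurveSurface_inter_torusLocus_nonempty_iff (P : MvPolynomial (Fin 2) ℂ) :
    ({w : Fin 2 ⊕ Fin 2 → ℂ | w (Sum.inl 1) = p.eval (w (Sum.inl 0)) ∧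
        MvPolynomial.eval (fun i => w (Sum.inr i)) P = 0} ∩ torusLocus ℂ 2).Nonempty ↔
      ∃ c : Fin 2 → ℂ, c 0 ≠ 0 ∧ c 1 ≠ 0 ∧ MvPolynomial.eval c P = 0 := by
  constructor
  · rintro ⟨w, hwS, hwT⟩
    exact ⟨fun i => w (Sum.inr i), hwT 0, hwT 1, hwS.2⟩
  · rintro ⟨c, h0, h1, hc⟩
    refine ⟨Sum.elim ![0, p.eval 0] c, ⟨by simp, ?_⟩, fun i => ?_⟩
    · simpa using hc
    · fin_cases i
      · simpa using h0
      · simpa using h1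

/-- `π(W(p; P) ∩ G²)` is the base curve `{x₁ = p(x₀)}` as soon as `Z(P)` has a torus point (pair
every base point with that torus point); it coincides with the additive projection of the crossed
graph surface `{x₁ = p(x₀), y₀ = y₁}`, so all base invariants transfer. (new) -/
theorem projAdd_image_graphCurveSurface_inter_torusLocus
    (hW : ({w : Fin 2 ⊕ Fin 2 → ℂ | w (Sum.inl 1) = p.eval (w (Sum.inl 0)) ∧
        MvPolynomial.eval (fun i => w (Sum.inr i)) P = 0} ∩ torusLocus ℂ 2).Nonempty) :
    projAdd '' ({w : Fin 2 ⊕ Fin 2 → ℂ | w (Sum.inl 1) = p.eval (w (Sum.inl 0)) ∧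
        MvPolynomial.eval (fun i => w (Sum.inr i)) P = 0} ∩ torusLocus ℂ 2) =
      projAdd '' (graphPolySurface p Polynomial.X ∩ torusLocus ℂ 2) := by
  obtain ⟨c, h0, h1, hc⟩ := (graphCurveSurface_inter_torusLocus_nonempty_iff p P).1 hW
  rw [projAdd_image_graphPolySurface_inter_torusLocus _ Polynomial.X_ne_zero]
  ext x
  simp only [Set.mem_image, Set.mem_inter_iff, graphBase, Set.mem_setOf_eq,
    eval_polynomial_aeval_X]
  constructor
  · rintro ⟨w, ⟨hw, -⟩, rfl⟩
    simpa using hw.1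
  · intro hx
    refine ⟨Sum.elim x c, ⟨⟨?_, by simpa using hc⟩, fun i => ?_⟩, ?_⟩
    · have h' : x 1 = p.eval (x 0) := by simpa using hx
      simpa using h'
    · fin_cases i
      · simpa using h0
      · simpa using h1
    · funext i
      simp

/-- **`dim cl π(W ∩ G²) = 1`** (given a torus zero of `P`). (new) -/
theorem addProjDim_graphCurveSurface
    (hW : ({w : Fin 2 ⊕ Fin 2 → ℂ | w (Sum.inl 1) = p.eval (w (Sum.inl 0)) ∧
        MvPolynomial.eval (fun i => w (Sum.inr i)) P = 0} ∩ torusLocus ℂ 2).Nonempty) :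
    addProjDim ℂ 2 {w : Fin 2 ⊕ Fin 2 → ℂ | w (Sum.inl 1) = p.eval (w (Sum.inl 0)) ∧
        MvPolynomial.eval (fun i => w (Sum.inr i)) P = 0} = (1 : ℕ) := by
  unfold addProjDim
  rw [projAdd_image_graphCurveSurface_inter_torusLocus p hW]
  exact addProjDim_graphPolySurface _ Polynomial.X_ne_zero

/-- **The closure of the base is not a line of rational slope** (`deg p ≥ 2`, a torus zero of `P`).
(new) -/
theorem not_isRationalSlopeLine_graphCurveSurface (hd : 2 ≤ p.natDegree)
    (hW : ({w : Fin 2 ⊕ Fin 2 → ℂ | w (Sum.inl 1) = p.eval (w (Sum.inl 0)) ∧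
        MvPolynomial.eval (fun i => w (Sum.inr i)) P = 0} ∩ torusLocus ℂ 2).Nonempty) :
    ¬ IsRationalSlopeLine (zeroLocus ℂ (vanishingIdeal ℂ
        (projAdd '' ({w : Fin 2 ⊕ Fin 2 → ℂ | w (Sum.inl 1) = p.eval (w (Sum.inl 0)) ∧
          MvPolynomial.eval (fun i => w (Sum.inr i)) P = 0} ∩ torusLocus ℂ 2)))) := by
  rw [projAdd_image_graphCurveSurface_inter_torusLocus p hW]
  exact not_isRationalSlopeLine_graphPolySurface _ Polynomial.X_ne_zero
    (coeffs_eq_zero_of_two_le_natDegree hd)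

/-- **Case certificate.** For irreducible `P ∈ ℂ[y₀, y₁]` with a zero in `(ℂˣ)²` and
`deg p ≥ 2`, the surface `W(p; P)` satisfies the hypotheses of Mantova–Masser's case
(dim-π-S-1-free). (new) -/
theorem mmCase_graphCurveSurface (hd : 2 ≤ p.natDegree) (hirr : Irreducible P)
    (hW : ({w : Fin 2 ⊕ Fin 2 → ℂ | w (Sum.inl 1) = p.eval (w (Sum.inl 0)) ∧
        MvPolynomial.eval (fun i => w (Sum.inr i)) P = 0} ∩ torusLocus ℂ 2).Nonempty) :
    MMCaseDimPiOneFree {w : Fin 2 ⊕ Fin 2 → ℂ | w (Sum.inl 1) = p.eval (w (Sum.inl 0)) ∧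
        MvPolynomial.eval (fun i => w (Sum.inr i)) P = 0} :=
  ⟨isIrreducibleClosed_graphCurveSurface p hirr, hW, zariskiDim_graphCurveSurface p hirr,
    addProjDim_graphCurveSurface p hW, not_isRationalSlopeLine_graphCurveSurface p hd hW⟩

/-- **Mantova–Masser's question on the family: case ∧ dense.**  For `deg p ≥ 2` and irreducible
`P` with a torus zero and two monomials of different `y₁`-degree, `W(p; P)` is in case
(dim-π-S-1-free) AND its exponential points are Zariski dense.
[cite: MantovaMasser2023, §1 Further remarks, p. 5 (the question, open in general)] (new) -/
theorem unprojectedDensityQuestion_instance_graphCurve (hd : 2 ≤ p.natDegree)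
    (hirr : Irreducible P) (h2 : ∃ v ∈ P.support, ∃ v' ∈ P.support, v 1 ≠ v' 1)
    {c : Fin 2 → ℂ} (h0 : c 0 ≠ 0) (h1 : c 1 ≠ 0) (hc : MvPolynomial.eval c P = 0) :
    MMCaseDimPiOneFree {w : Fin 2 ⊕ Fin 2 → ℂ | w (Sum.inl 1) = p.eval (w (Sum.inl 0)) ∧
        MvPolynomial.eval (fun i => w (Sum.inr i)) P = 0} ∧
      UnprojectedDense {w : Fin 2 ⊕ Fin 2 → ℂ | w (Sum.inl 1) = p.eval (w (Sum.inl 0)) ∧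
        MvPolynomial.eval (fun i => w (Sum.inr i)) P = 0} :=
  ⟨mmCase_graphCurveSurface p hd hirr
      ((graphCurveSurface_inter_torusLocus_nonempty_iff p P).2 ⟨c, h0, h1, hc⟩),
    unprojectedDense_graphCurveSurface p hd hirr h2⟩

/-- **The question holds on the family whenever it is posed**: if `deg p ≥ 2`, `P` is irreducible
with two monomials of different `y₁`-degree and `W(p; P)` is in case (dim-π-S-1-free), then its
exponential points are Zariski dense. (new) -/
theorem unprojectedDense_graphCurveSurface_of_mmCase (hd : 2 ≤ p.natDegree)
    (hirr : Irreducible P) (h2 : ∃ v ∈ P.support, ∃ v' ∈ P.support, v 1 ≠ v' 1)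
    (_h : MMCaseDimPiOneFree {w : Fin 2 ⊕ Fin 2 → ℂ | w (Sum.inl 1) = p.eval (w (Sum.inl 0)) ∧
        MvPolynomial.eval (fun i => w (Sum.inr i)) P = 0}) :
    UnprojectedDense {w : Fin 2 ⊕ Fin 2 → ℂ | w (Sum.inl 1) = p.eval (w (Sum.inl 0)) ∧
        MvPolynomial.eval (fun i => w (Sum.inr i)) P = 0} :=
  unprojectedDense_graphCurveSurface p hd hirr h2

end Case

/-! ## Part B. Examples with non-graph fibre curves -/

section Examples

/-- The circle polynomial `y₀² + y₁² - r` has the monomials `1` and `y₁²`, of different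
`y₁`-degree (`r ≠ 0`). -/
theorem circlePoly_support_pair {r : ℂ} (hr : r ≠ 0) :
    ∃ v ∈ (X 0 ^ 2 + X 1 ^ 2 - MvPolynomial.C r : MvPolynomial (Fin 2) ℂ).support,
      ∃ v' ∈ (X 0 ^ 2 + X 1 ^ 2 - MvPolynomial.C r : MvPolynomial (Fin 2) ℂ).support,
        v 1 ≠ v' 1 := by
  classical
  have h01 : (Finsupp.single (0 : Fin 2) 2 : Fin 2 →₀ ℕ) ≠ Finsupp.single 1 2 := by
    intro h
    have := Finsupp.single_left_injective (by norm_num : (2 : ℕ) ≠ 0) |>.eq_iff.1 h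
    exact absurd this (by decide)
  have h10 : (0 : Fin 2 →₀ ℕ) ≠ Finsupp.single 1 2 :=
    (Finsupp.single_ne_zero.2 (by norm_num)).symm
  refine ⟨0, ?_, Finsupp.single 1 2, ?_, ?_⟩
  · rw [MvPolynomial.mem_support_iff]
    simp [MvPolynomial.coeff_X_pow, hr]
  · rw [MvPolynomial.mem_support_iff]
    simp [MvPolynomial.coeff_X_pow, h01, h10]
  · simp

/-- `y₀² + y₁² - r` is irreducible for `r ≠ 0` (a smooth conic; `EACCyclicCoverBases`). -/
theorem irreducible_circlePoly {r : ℂ} (hr : r ≠ 0) :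
    Irreducible (X 0 ^ 2 + X 1 ^ 2 - MvPolynomial.C r : MvPolynomial (Fin 2) ℂ) := by
  have h := irreducible_sumSq_sub_C (s := 0) r (Or.inr hr)
  have e : (∑ i : Fin (0 + 2), X i ^ 2 - MvPolynomial.C r : MvPolynomial (Fin (0 + 2)) ℂ) =
      (X 0 ^ 2 + X 1 ^ 2 - MvPolynomial.C r : MvPolynomial (Fin 2) ℂ) := by
    rw [Fin.sum_univ_two]
  rw [e] at h
  exact h

/-- **Parabola × circle.**  The surface `{x₁ = x₀², y₀² + y₁² = 2} ⊆ ℂ² × ℂ²` — base the parabola,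
fibre the smooth conic `y₀² + y₁² = 2`, which is a graph over NEITHER multiplicative coordinate —
is in Mantova–Masser's case (dim-π-S-1-free) and its exponential points `(z, z², e^z, e^{z²})`,
`e^{2z} + e^{2z²} = 2`, are Zariski dense. (new) -/
theorem unprojectedDensityQuestion_instance_parabola_circle :
    MMCaseDimPiOneFree {w : Fin 2 ⊕ Fin 2 → ℂ |
        w (Sum.inl 1) = (Polynomial.X ^ 2 : Polynomial ℂ).eval (w (Sum.inl 0)) ∧
        MvPolynomial.eval (fun i => w (Sum.inr i))
          (X 0 ^ 2 + X 1 ^ 2 - MvPolynomial.C 2 : MvPolynomial (Fin 2) ℂ) = 0} ∧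
      UnprojectedDense {w : Fin 2 ⊕ Fin 2 → ℂ |
        w (Sum.inl 1) = (Polynomial.X ^ 2 : Polynomial ℂ).eval (w (Sum.inl 0)) ∧
        MvPolynomial.eval (fun i => w (Sum.inr i))
          (X 0 ^ 2 + X 1 ^ 2 - MvPolynomial.C 2 : MvPolynomial (Fin 2) ℂ) = 0} := by
  have hd : 2 ≤ (Polynomial.X ^ 2 : Polynomial ℂ).natDegree := by simp
  have h0 : (![1, 1] : Fin 2 → ℂ) 0 ≠ 0 := by simp
  have h1 : (![1, 1] : Fin 2 → ℂ) 1 ≠ 0 := by simp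
  have hc : MvPolynomial.eval (![1, 1] : Fin 2 → ℂ)
      (X 0 ^ 2 + X 1 ^ 2 - MvPolynomial.C 2 : MvPolynomial (Fin 2) ℂ) = 0 := by
    norm_num
  exact unprojectedDensityQuestion_instance_graphCurve (Polynomial.X ^ 2) hd
    (irreducible_circlePoly two_ne_zero) (circlePoly_support_pair two_ne_zero) h0 h1 hc

/-- **Cubic × Fermat conic.**  The surface `{x₁ = x₀³ - x₀, y₀² + y₁² = 1}` is in
Mantova–Masser's case and has Zariski-dense exponential points (torus zero `(3/5, 4/5)` of the
fibre). (new) -/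
theorem unprojectedDensityQuestion_instance_cubic_fermatConic :
    MMCaseDimPiOneFree {w : Fin 2 ⊕ Fin 2 → ℂ |
        w (Sum.inl 1) = (Polynomial.X ^ 3 - Polynomial.X : Polynomial ℂ).eval (w (Sum.inl 0)) ∧
        MvPolynomial.eval (fun i => w (Sum.inr i))
          (X 0 ^ 2 + X 1 ^ 2 - MvPolynomial.C 1 : MvPolynomial (Fin 2) ℂ) = 0} ∧
      UnprojectedDense {w : Fin 2 ⊕ Fin 2 → ℂ |
        w (Sum.inl 1) = (Polynomial.X ^ 3 - Polynomial.X : Polynomial ℂ).eval (w (Sum.inl 0)) ∧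
        MvPolynomial.eval (fun i => w (Sum.inr i))
          (X 0 ^ 2 + X 1 ^ 2 - MvPolynomial.C 1 : MvPolynomial (Fin 2) ℂ) = 0} := by
  have hd : 2 ≤ (Polynomial.X ^ 3 - Polynomial.X : Polynomial ℂ).natDegree := by
    rw [Polynomial.natDegree_sub_eq_left_of_natDegree_lt] <;> simp
  have h0 : (![(3 : ℂ) / 5, 4 / 5] : Fin 2 → ℂ) 0 ≠ 0 := by norm_num
  have h1 : (![(3 : ℂ) / 5, 4 / 5] : Fin 2 → ℂ) 1 ≠ 0 := by norm_num
  have hc : MvPolynomial.eval (![(3 : ℂ) / 5, 4 / 5] : Fin 2 → ℂ)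
      (X 0 ^ 2 + X 1 ^ 2 - MvPolynomial.C 1 : MvPolynomial (Fin 2) ℂ) = 0 := by
    norm_num
  exact unprojectedDensityQuestion_instance_graphCurve (Polynomial.X ^ 3 - Polynomial.X) hd
    (irreducible_circlePoly one_ne_zero) (circlePoly_support_pair one_ne_zero) h0 h1 hc

/-- The equation form of the first example: `(e^{z})² + (e^{z²})² = 2` has solutions (in fact
solutions with `Re z → -∞`; here just one consequence). (new) -/
theorem exp_sq_add_exp_sq_sq_solvable :
    ∃ z : ℂ, exp z ^ 2 + exp (z ^ 2) ^ 2 = 2 := by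
  obtain ⟨z, hz, -⟩ := exists_graphCurve_expPoints (Polynomial.X ^ 2) (by simp)
    (X 0 ^ 2 + X 1 ^ 2 - MvPolynomial.C 2 : MvPolynomial (Fin 2) ℂ)
    (circlePoly_support_pair two_ne_zero)
  refine ⟨z 0, ?_⟩
  have h := hz 0
  simp at h
  linear_combination h

end Examples

/-! ## Part C. Graphs over the other axis -/

/-- **Bases `x₀ = p(x₁)`.**  The index swap `0 ↔ 1` on both factors (`EACDensityTransport`)
carries `{x₀ = p(x₁)} × Z(P)` to `{x₁ = p(x₀)} × Z(P^σ)`; hence for `deg p ≥ 2` and irreducible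
`P` with two monomials of different `y₀`-degree the exponential points of `{x₀ = p(x₁)} × Z(P)`
are Zariski dense. (new) -/
theorem unprojectedDense_graphCurveSurface_swap (p : Polynomial ℂ) (hd : 2 ≤ p.natDegree)
    {P : MvPolynomial (Fin 2) ℂ} (hirr : Irreducible P)
    (h2 : ∃ v ∈ P.support, ∃ v' ∈ P.support, v 0 ≠ v' 0) :
    UnprojectedDense {w : Fin 2 ⊕ Fin 2 → ℂ | w (Sum.inl 0) = p.eval (w (Sum.inl 1)) ∧
      MvPolynomial.eval (fun i => w (Sum.inr i)) P = 0} := by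
  classical
  set σ : Fin 2 ≃ Fin 2 := Equiv.swap 0 1 with hσ
  set P' : MvPolynomial (Fin 2) ℂ := rename σ P with hP'
  have hirr' : Irreducible P' := (MulEquiv.irreducible_iff (renameEquiv ℂ σ)).2 hirr
  have h2' : ∃ v ∈ P'.support, ∃ v' ∈ P'.support, v 1 ≠ v' 1 := by
    obtain ⟨v, hv, v', hv', hne⟩ := h2
    refine ⟨Finsupp.mapDomain σ v, ?_, Finsupp.mapDomain σ v', ?_, ?_⟩
    · rw [hP', support_rename_of_injective σ.injective]; exact Finset.mem_image_of_mem _ hv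
    · rw [hP', support_rename_of_injective σ.injective]; exact Finset.mem_image_of_mem _ hv'
    · have e1 : (1 : Fin 2) = σ 0 := by simp [hσ]
      rw [e1, Finsupp.mapDomain_apply σ.injective, Finsupp.mapDomain_apply σ.injective]
      exact hne
  have hdense := unprojectedDense_graphCurveSurface p hd hirr' h2'
  have hset : indexSwapped {w : Fin 2 ⊕ Fin 2 → ℂ | w (Sum.inl 1) = p.eval (w (Sum.inl 0)) ∧
      MvPolynomial.eval (fun i => w (Sum.inr i)) P' = 0} =
      {w : Fin 2 ⊕ Fin 2 → ℂ | w (Sum.inl 0) = p.eval (w (Sum.inl 1)) ∧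
        MvPolynomial.eval (fun i => w (Sum.inr i)) P = 0} := by
    ext w
    have e : MvPolynomial.eval (fun i => (w ∘ idxSwap) (Sum.inr i)) P' =
        MvPolynomial.eval (fun i => w (Sum.inr i)) P := by
      rw [hP', eval_rename]
      have hfun : ((fun i => (w ∘ idxSwap) (Sum.inr i)) ∘ ⇑σ) = fun i => w (Sum.inr i) := by
        funext i
        fin_cases i <;> simp [hσ, idxSwap_inr]
      rw [hfun]
    simp only [mem_indexSwapped_iff, Set.mem_setOf_eq, e]
    simp
  rw [← hset]
  exact unprojectedDense_indexSwapped hdense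

end Summit.Schanuel.Schanuel.Theorems
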